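import Summits.Ventures.CertifiedManyBodySolver.Certificates.HubbardSquare_transportClosure_Kit
import HarnessLib

/-!
# Ventures/CertifiedManyBodySolver — Certificates/HubbardSquare_transportClosure_KitU.lean
# (hubbard-fast-reuse-5 g5, cell hubbard-fast, D-0154 (A) CERTIFICATE REUSE: the TRANSPORT-CLOSURE kit, part 9 = FLOORS CARRIED DOWN in `U`;
# located by hubbard-fast-surr-3 g4 (05:10Z, «carry-DOWN» device), law = the tree's `energyDensityTT'_ge_sub_mul_sq_U`)

`KitLaws.tc_mlFloor_Umono_above` carries a floor UP in `U` (`e₀` non-decreasing in `U`) and `tc_mlCap_Umono_below` a cap DOWN. The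
missing fourth move — a FLOOR carried DOWN in `U` — is not free but has an exact price: concavity of `e₀` in `U` on `[0, U₀]` together with
the Hartree–Fock ceiling `e₀(t,s,U,n) ≤ e₀(t,s,0,n) + U(n/2)²` (`TTPrimeFree.energyDensityTT'_le_free_add_interaction`) bound the chord slope by
`(n/2)²`, whence `e₀(t,s,U',n) ≥ e₀(t,s,U₀,n) − (U₀ − U')(n/2)²` for `0 ≤ U' ≤ U₀` (`energyDensityTT'_ge_sub_mul_sq_U`,
`HubbardNNNHoppingEnergyDensityRegionBounds` §; used ad hoc by the pinning / off-census cells, never as a kit law). This file states it in the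
cell's `_mlword_Icc` shape: `tc_mlFloor_Udown` takes a bilinear `U`-slice floor `A(s,n) ≤ e₀(t,s,U₀,n)` (the `tc_sliceU_floor` / `tc_sheetT_floor`
shape) and returns, on every cell `[Ua, Ub] × [s₁, s₂] × [n₁, n₂]` with `0 ≤ Ua`, `Ub ≤ U₀`, `0 ≤ n₁`, `n₂ < 2`, the floor
`A(θ1, θ2) − (U₀ − θ0)·((n₁ + n₂)θ2 − n₁n₂)/4 ≤ e₀` — the quadratic `(θ2/2)²` replaced by its CHORD on `[n₁, n₂]` (a parabola lies below its
chord), which makes the bound exactly TRILINEAR; a literal 8-coefficient form below it at the eight vertices is a floor on the cell (vertex rule).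
Use: a producer row / image sheet at `(s₀, U₀)` now reaches the strip just BELOW its own `U₀` (loss `ΔU·(n/2)²`, e.g. `0.1 × 0.255` for the
`U = 4.9` edge column of the YBa₂Cu₃O₆ hull from the `U₀ = 5` image rung).
HONEST FRAMING: a bookkeeping adapter around one tree lemma; certifies nothing by itself; every consumer word inherits exactly the hypotheses
of the words it cites; no number of record; not a phase word; no summit statement is proved here; not a superconductivity verdict.
-/

namespace Summit.Ventures.CertifiedManyBodySolver.Certificates

open Literature.MathematicalPhysics.QuantumLattice
open Literature.MathematicalPhysics.QuantumLattice.ThermodynamicLimit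
open Set

/-- **FLOOR CARRIED DOWN IN `U`** (concavity in `U` + the Hartree–Fock slope bound, `energyDensityTT'_ge_sub_mul_sq_U`): a bilinear floor
`α₀ + α₁s + α₂n + α₃sn ≤ e₀(t, s, U₀, n)` on `[s₁, s₂] × [n₁, n₂]` gives, for `0 ≤ Ua ≤ θ0 ≤ Ub ≤ U₀`,
`e₀(θ) ≥ A(θ1, θ2) − (U₀ − θ0)(θ2/2)² ≥ A(θ1, θ2) − (U₀ − θ0)((n₁ + n₂)θ2 − n₁n₂)/4`; a literal trilinear form below the right-hand side at
the eight vertices of the cell is a floor on the cell. [cite: BachLiebSolovej1994, eq. (2c.36)] [cite: Israel1979, Thm. I.3.4] -/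
theorem tc_mlFloor_Udown (t : ℝ) {U₀ Ua Ub s₁ s₂ n₁ n₂ α₀ α₁ α₂ α₃ c₀ c₁ c₂ c₃ c₄ c₅ c₆ c₇ : ℝ}
    (hUa : 0 ≤ Ua) (hUb : Ub ≤ U₀) (hn₁ : 0 ≤ n₁) (hn₂ : n₂ < 2)
    (hA : ∀ s n : ℝ, s₁ ≤ s → s ≤ s₂ → n₁ ≤ n → n ≤ n₂ →
      α₀ + α₁ * s + α₂ * n + α₃ * s * n ≤ energyDensityTT' t s U₀ n)
    (v₁₁₁ : c₀ + c₁ * Ua + c₂ * s₁ + c₃ * n₁ + c₄ * Ua * s₁ + c₅ * Ua * n₁ + c₆ * s₁ * n₁ + c₇ * Ua * s₁ * n₁ ≤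
      (α₀ + α₁ * s₁ + α₂ * n₁ + α₃ * s₁ * n₁) - (U₀ - Ua) * ((n₁ + n₂) * n₁ - n₁ * n₂) / 4)
    (v₁₁₂ : c₀ + c₁ * Ua + c₂ * s₁ + c₃ * n₂ + c₄ * Ua * s₁ + c₅ * Ua * n₂ + c₆ * s₁ * n₂ + c₇ * Ua * s₁ * n₂ ≤
      (α₀ + α₁ * s₁ + α₂ * n₂ + α₃ * s₁ * n₂) - (U₀ - Ua) * ((n₁ + n₂) * n₂ - n₁ * n₂) / 4)
    (v₁₂₁ : c₀ + c₁ * Ua + c₂ * s₂ + c₃ * n₁ + c₄ * Ua * s₂ + c₅ * Ua * n₁ + c₆ * s₂ * n₁ + c₇ * Ua * s₂ * n₁ ≤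
      (α₀ + α₁ * s₂ + α₂ * n₁ + α₃ * s₂ * n₁) - (U₀ - Ua) * ((n₁ + n₂) * n₁ - n₁ * n₂) / 4)
    (v₁₂₂ : c₀ + c₁ * Ua + c₂ * s₂ + c₃ * n₂ + c₄ * Ua * s₂ + c₅ * Ua * n₂ + c₆ * s₂ * n₂ + c₇ * Ua * s₂ * n₂ ≤
      (α₀ + α₁ * s₂ + α₂ * n₂ + α₃ * s₂ * n₂) - (U₀ - Ua) * ((n₁ + n₂) * n₂ - n₁ * n₂) / 4)
    (v₂₁₁ : c₀ + c₁ * Ub + c₂ * s₁ + c₃ * n₁ + c₄ * Ub * s₁ + c₅ * Ub * n₁ + c₆ * s₁ * n₁ + c₇ * Ub * s₁ * n₁ ≤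
      (α₀ + α₁ * s₁ + α₂ * n₁ + α₃ * s₁ * n₁) - (U₀ - Ub) * ((n₁ + n₂) * n₁ - n₁ * n₂) / 4)
    (v₂₁₂ : c₀ + c₁ * Ub + c₂ * s₁ + c₃ * n₂ + c₄ * Ub * s₁ + c₅ * Ub * n₂ + c₆ * s₁ * n₂ + c₇ * Ub * s₁ * n₂ ≤
      (α₀ + α₁ * s₁ + α₂ * n₂ + α₃ * s₁ * n₂) - (U₀ - Ub) * ((n₁ + n₂) * n₂ - n₁ * n₂) / 4)
    (v₂₂₁ : c₀ + c₁ * Ub + c₂ * s₂ + c₃ * n₁ + c₄ * Ub * s₂ + c₅ * Ub * n₁ + c₆ * s₂ * n₁ + c₇ * Ub * s₂ * n₁ ≤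
      (α₀ + α₁ * s₂ + α₂ * n₁ + α₃ * s₂ * n₁) - (U₀ - Ub) * ((n₁ + n₂) * n₁ - n₁ * n₂) / 4)
    (v₂₂₂ : c₀ + c₁ * Ub + c₂ * s₂ + c₃ * n₂ + c₄ * Ub * s₂ + c₅ * Ub * n₂ + c₆ * s₂ * n₂ + c₇ * Ub * s₂ * n₂ ≤
      (α₀ + α₁ * s₂ + α₂ * n₂ + α₃ * s₂ * n₂) - (U₀ - Ub) * ((n₁ + n₂) * n₂ - n₁ * n₂) / 4) :
    ∀ θ ∈ Set.Icc (![Ua, s₁, n₁] : Fin 3 → ℝ) ![Ub, s₂, n₂],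
      c₀ + c₁ * θ 0 + c₂ * θ 1 + c₃ * θ 2 + c₄ * θ 0 * θ 1 + c₅ * θ 0 * θ 2 + c₆ * θ 1 * θ 2 +
        c₇ * θ 0 * θ 1 * θ 2 ≤ energyDensityTT' t (θ 1) (θ 0) (θ 2) := by
  intro θ hθ
  obtain ⟨⟨k1, k2⟩, ⟨k3, k4⟩, ⟨k5, k6⟩⟩ := mem_Icc_vec3_iff.1 hθ
  have hU0 : 0 ≤ θ 0 := hUa.trans k1
  have hn0 : 0 ≤ θ 2 := hn₁.trans k5
  have hn2 : θ 2 < 2 := lt_of_le_of_lt k6 hn₂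
  have hA' := hA (θ 1) (θ 2) k3 k4 k5 k6
  -- the law: floor at U₀ carried down to θ0 ≤ U₀ at the Hartree–Fock price
  have hlaw := energyDensityTT'_ge_sub_mul_sq_U t (θ 1) hn0 hn2 hU0 (k2.trans hUb)
  -- parabola below its chord on [n₁, n₂]
  have hsq : (θ 2 / 2) ^ 2 ≤ ((n₁ + n₂) * θ 2 - n₁ * n₂) / 4 := by nlinarith [mul_nonneg (sub_nonneg.2 k5) (sub_nonneg.2 k6)]
  have hdU : 0 ≤ U₀ - θ 0 := by linarith [k2.trans hUb]
  have hprod : (U₀ - θ 0) * (θ 2 / 2) ^ 2 ≤ (U₀ - θ 0) * (((n₁ + n₂) * θ 2 - n₁ * n₂) / 4) :=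
    mul_le_mul_of_nonneg_left hsq hdU
  -- the trilinear majorant is above the literal form on the whole cell (vertex rule)
  have hv := trilinear_nonneg_on_Icc₃ (a₀ := Ua) (a₁ := s₁) (a₂ := n₁) (b₀ := Ub) (b₁ := s₂) (b₂ := n₂)
    (c₀ := α₀ + U₀ * n₁ * n₂ / 4 - c₀) (c₁ := -(n₁ * n₂) / 4 - c₁) (c₂ := α₁ - c₂)
    (c₃ := α₂ - U₀ * (n₁ + n₂) / 4 - c₃) (c₄ := -c₄) (c₅ := (n₁ + n₂) / 4 - c₅) (c₆ := α₃ - c₆) (c₇ := -c₇)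
    (by linear_combination v₁₁₁) (by linear_combination v₁₁₂) (by linear_combination v₁₂₁)
    (by linear_combination v₁₂₂) (by linear_combination v₂₁₁) (by linear_combination v₂₁₂)
    (by linear_combination v₂₂₁) (by linear_combination v₂₂₂) θ hθ
  linear_combination hA' + hlaw + hprod + hv

end Summit.Ventures.CertifiedManyBodySolver.Certificates
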